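import Literature.Analysis.Complex.EarleHamiltonBall
import Literature.MathematicalPhysics.QuantumFieldTheory.Balaban1983to89.B13SigmaThroughWalks

/-!
# `Balaban1983to89.B13ExpansionAnalytic` — T. Bałaban, *Renormalization group approach to lattice gauge field theories.
II. Cluster expansions*, Commun. Math. Phys. **116** (1988) 1–22 [Balaban1988RG2Cluster], p. 15: *"The quadratic forms
and covariances in H(Z) are analytic functions on the space of configurations (U, J) satisfying the conditions
I.(i)–(iii) on the domain Z, with constants α′₀, α′₁ much bigger than α₀, α₁"* — the (T3b) ANALYTICITY HALF of the
cell's NODE A.4 FROM THE SAME OBJECT as (T3a): if the kernel family `u ↦ K(σ,u)` is the entrywise `HasSum` of walk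
terms each of which is complex analytic in the configuration `u` on the `R`-ball, with per-term bounds uniform on
polydisc × ball and summable majorants, then every entry of `K(σ,·)` is complex analytic on the `R`-ball (termwise
differentiability + Cauchy estimates for the Fréchet derivatives on a smaller ball + Mathlib's
`hasFDerivAt_tsum_of_isPreconnected`); whence the GRAND CAPSTONE `differences216_of_walks`: `Differences216` (L16a,
the (2.16)-type σ-difference bounds feeding (2.26)) for one (2.14)-term from THREE WALK EXPANSIONS (Γ-kernel,
precision, covariance) with their printed structure — NO (2.16)-type bound, NO L17a-type majorant and NO analyticity
clause is assumed: all six kernel binders `hG hΓ₀ hCs hC216 ∣ hdΓ hdE` of r10's `h226_torus_of_primitives` become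
theorems about the expansions

statement-level skeleton of published theorems with citation tags; proofs where landed; nothing here is a claim about
the Yang–Mills mass gap

Sources: [II] = [Balaban1988RG2Cluster] p. 5 (1.11), p. 13, p. 15, p. 16 (2.16) (quoted verbatim, render-checked, in
the header of `B13SigmaThroughWalks`); [B9] = [Balaban1985BackgroundPropagators] Thm 3.10 p. 416 *"A term in this
expansion, corresponding to a walk ω, depends on configuration U restricted to X̃₀⁵ ∪ X̃₁⁵ ∪ … ∪ X̃ₙ⁵"* and *"From (3.108)
it follows that the expansion (3.107) is convergent"* (header of `B9SectDWalk`).  The complex-analysis step (Cauchy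
estimate for the Fréchet derivative of a bounded scalar holomorphic map on a ball of a complex normed space) is the
tree's `Literature.Analysis.Complex.EarleHamilton.norm_fderiv_le_div_of_mapsTo_ball` (REUSED, not restated).

WHAT IS REPRODUCED (cell `pub-balaban-gaps`, track G1, prover seat g1-p2 gen 3; binder (D4), NODE A.4 = (T3), item
(T3b); a NEW LEAF over `B13SigmaThroughWalks` (this seat) and `EarleHamiltonBall`; nothing edited):
* §1 `norm_fderiv_apply_le_of_norm_le`, `norm_fderiv_le_of_norm_le` — Cauchy's estimate for a scalar map `h` complex
  differentiable on the ball `‖x‖ < R` of a complex normed space with `‖h‖ ≤ M` there: `‖Dh(x)‖ ≤ M ∕ (R − ‖x‖)`.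
* §2 `differentiableOn_of_hasSum` — TERMWISE ANALYTICITY PASSES TO THE EXPANSION: terms `F_ω` complex differentiable on
  the `R`-ball with `‖F_ω‖ ≤ M_ω` there, `Σ_ω M_ω < ∞`, and `K(x) = Σ_ω F_ω(x)` (`HasSum`) on the ball ⟹ `K` complex
  differentiable on the (same, open) `R`-ball.
* §3 `differentiableOn_torus_of_hasSum` — on polydisc × ball with walk majorants `A_ω e^{−ρD_ω(loc b, loc j)}` and a
  `MajSumLe` bound: LITERALLY the (T3b) analyticity binder shape `haΓ` ∕ `haE` of
  `B13SigmaThroughWalks.differences216_of_walks_two` (`∀ σ, (∀ j, ‖σ j‖ ≤ e^{κ₁}) → ∀ b j, DifferentiableOn ℂ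
  (fun u => K σ u b j) (ball 0 R)`).
* §4 `differences216_of_walks` — THE GRAND CAPSTONE (see above); constants `K_G := K̄_Γ`, `K_E := K̄_E`, `K_Cs := K̄_C`,
  `θ_Γ = 2K̄_Γe^{−εR_σ} + 2K̄_Γα/R`, `θ_E = 2K̄_Ee^{−εR_σ} + 2K̄_Eα/R`, `θ_C` derived (resolvent identity).
CENSUS MEANING (row (D4).NODE-A, words unchanged): at NODE A.4 EVERY estimate-type input of (2.26) for one term —
uniform localisation (L17a), σ-differences (L16a∕(T3a)), analyticity in (𝐔, 𝐉) ((T3b)) — is a kernel theorem about ONE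
kind of OBJECT: the generalized random walk expansions of the term's three kernel families, with (1.11)∕(3.108)-shape
terms analytic in the configuration, summable majorants with two rate drops to spare, and the s-monomial structure
(σ carried by walks through the far region).  By assertion remain exactly: the EXISTENCE of these expansions for
Bałaban's operators in complex backgrounds ([13] Thm 3.15-type, cell GAPS G-B9-10) with k-UNIFORM constants ([9]
Sect. A, (v)), and `TermDomination` for Bałaban's H — both OBJECT-level (NODE O).
HONEST SCOPE.  Complex analysis in a Banach parameter (Cauchy estimate, differentiability of a normally convergent
series) and plumbing; no walk expansion of any operator of Bałaban's is constructed; (D4) NOT discharged (instance 0∕1).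
No `sorry`, no definition, no new named fact.  NOT B12 Thm 2, NOT `BetaPertH`, NOT continuum∕ℝ⁴, NOT Clay.
-/

namespace Literature.MathematicalPhysics.QuantumFieldTheory.Balaban1983to89.B13ExpansionAnalytic

open Metric Set Matrix Finset Filter
open scoped Topology
open Literature.MathematicalPhysics.QuantumFieldTheory.Balaban1983to89
open Literature.MathematicalPhysics.QuantumFieldTheory.Balaban1983to89.B9SectDWalk (Through MajSumLe)
open Literature.MathematicalPhysics.QuantumFieldTheory.Balaban1983to89.B9Thm34Ext (toB6)
open Literature.MathematicalPhysics.QuantumFieldTheory.Balaban1983to89.B9Thm37GlueTorus (torusGeom tdist1 tdist1_nonneg)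
open Literature.MathematicalPhysics.QuantumFieldTheory.Balaban1983to89.TreeLengthTorus (TPt)
open Literature.MathematicalPhysics.QuantumFieldTheory.Balaban1983to89.B5TorusCover (UT)
open Literature.MathematicalPhysics.QuantumFieldTheory.Balaban1983to89.B13PrimitiveKernels216 (Differences216)
open Literature.MathematicalPhysics.QuantumFieldTheory.Balaban1983to89.B13SigmaThroughWalks
  (SigmaThroughWalks sub_ref_entry_le_torus majorant_torus_of_hasSum differences216_of_walks_two
    entry_le_of_hasSum_majorants)
open Literature.Analysis.Complex.EarleHamilton (norm_fderiv_le_div_of_mapsTo_ball)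

noncomputable section

/-! ## §1. Cauchy's estimate for the Fréchet derivative of a bounded scalar holomorphic map on a ball -/

section Cauchy

variable {E : Type*} [NormedAddCommGroup E] [NormedSpace ℂ E]

/-- **Cauchy's estimate along a direction**: `h : E → ℂ` complex differentiable on the ball `‖x‖ < R` with `‖h‖ ≤ M` there
satisfies `‖Dh(x)v‖ ≤ (M ∕ (R − ‖x‖))·‖v‖` — the one-variable Cauchy inequality on the complex line `x + ζv`
(`EarleHamilton.norm_fderiv_le_div_of_mapsTo_ball` for the scaled map `h ∕ M′`, `M′ ↓ M`). [folklore] -/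
private theorem norm_fderiv_apply_le_of_norm_le {h : E → ℂ} {R M : ℝ} (hd : DifferentiableOn ℂ h (ball (0 : E) R))
    (hM : ∀ x ∈ ball (0 : E) R, ‖h x‖ ≤ M) {x : E} (hx : x ∈ ball (0 : E) R) (v : E) :
    ‖fderiv ℂ h x v‖ ≤ M / (R - ‖x‖) * ‖v‖ := by
  have hxR : ‖x‖ < R := mem_ball_zero_iff.1 hx
  have hgap : 0 < R - ‖x‖ := sub_pos.2 hxR
  have hM0 : 0 ≤ M := (norm_nonneg _).trans (hM x hx)
  -- for every `M' > M` the scaled map `h / M'` takes the ball into the unit disc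
  have key : ∀ M' : ℝ, M < M' → ‖fderiv ℂ h x v‖ ≤ M' / (R - ‖x‖) * ‖v‖ := by
    intro M' hM'
    have hM'0 : 0 < M' := hM0.trans_lt hM'
    have hdg : DifferentiableOn ℂ (((M' : ℂ))⁻¹ • h) (ball (0 : E) R) := hd.const_smul _
    have hnorm : ‖((M' : ℂ))⁻¹‖ = M'⁻¹ := by
      rw [norm_inv, Complex.norm_real, Real.norm_of_nonneg hM'0.le]
    have hmg : MapsTo (((M' : ℂ))⁻¹ • h) (ball (0 : E) R) (ball (0 : ℂ) 1) := by
      intro y hy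
      rw [mem_ball_zero_iff, Pi.smul_apply, norm_smul, hnorm]
      calc M'⁻¹ * ‖h y‖ ≤ M'⁻¹ * M := by gcongr; exact hM y hy
        _ < 1 := by rw [inv_mul_lt_iff₀ hM'0]; linarith
    have hE := norm_fderiv_le_div_of_mapsTo_ball hdg hmg hx v
    have hfd : fderiv ℂ (((M' : ℂ))⁻¹ • h) x = ((M' : ℂ))⁻¹ • fderiv ℂ h x :=
      fderiv_const_smul (hd.differentiableAt (isOpen_ball.mem_nhds hx)) _
    rw [hfd, _root_.smul_apply, norm_smul, hnorm, inv_mul_le_iff₀ hM'0] at hE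
    calc ‖fderiv ℂ h x v‖ ≤ M' * (‖v‖ / (R - ‖x‖)) := hE
      _ = M' / (R - ‖x‖) * ‖v‖ := by ring
  refine le_of_forall_pos_le_add fun ε hε => ?_
  have hv1 : 0 < ‖v‖ + 1 := by positivity
  have hε' : 0 < ε * (R - ‖x‖) / (‖v‖ + 1) := by positivity
  calc ‖fderiv ℂ h x v‖ ≤ (M + ε * (R - ‖x‖) / (‖v‖ + 1)) / (R - ‖x‖) * ‖v‖ :=
        key _ (lt_add_of_pos_right M hε')
    _ = M / (R - ‖x‖) * ‖v‖ + ε * (‖v‖ / (‖v‖ + 1)) := by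
        field_simp
    _ ≤ M / (R - ‖x‖) * ‖v‖ + ε * 1 := by
        gcongr
        exact (div_le_one hv1).2 (by linarith)
    _ = M / (R - ‖x‖) * ‖v‖ + ε := by rw [mul_one]

/-- **Cauchy's estimate for the Fréchet derivative**: `h : E → ℂ` complex differentiable on the ball `‖x‖ < R` of a complex
normed space, `‖h‖ ≤ M` there ⟹ `‖Dh(x)‖ ≤ M ∕ (R − ‖x‖)` (operator norm). [folklore] -/
private theorem norm_fderiv_le_of_norm_le {h : E → ℂ} {R M : ℝ} (hd : DifferentiableOn ℂ h (ball (0 : E) R))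
    (hM : ∀ x ∈ ball (0 : E) R, ‖h x‖ ≤ M) {x : E} (hx : x ∈ ball (0 : E) R) :
    ‖fderiv ℂ h x‖ ≤ M / (R - ‖x‖) := by
  have hxR : ‖x‖ < R := mem_ball_zero_iff.1 hx
  have hM0 : 0 ≤ M := (norm_nonneg _).trans (hM x hx)
  exact ContinuousLinearMap.opNorm_le_bound _ (div_nonneg hM0 (sub_pos.2 hxR).le)
    fun v => norm_fderiv_apply_le_of_norm_le hd hM hx v

end Cauchy

/-! ## §2. Termwise analyticity passes to a normally convergent expansion -/

section Series

variable {E : Type*} [NormedAddCommGroup E] [NormedSpace ℂ E]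

/-- **TERMWISE ANALYTICITY PASSES TO THE EXPANSION** ([B9] Thm 3.10: each walk term is a finite product of local
operators, a function of the configuration on `X̃₀⁵ ∪ … ∪ X̃ₙ⁵`; [II] p. 15: the kernels *"are analytic functions on the
space of configurations (U, J) … with constants α′₀, α′₁ much bigger than α₀, α₁"*): if every term `F_ω : E → ℂ` is
complex differentiable on the ball `‖u‖ < R` of the configuration space with `‖F_ω‖ ≤ M_ω` there, `Σ_ω M_ω < ∞`, and
`K(u) = Σ_ω F_ω(u)` (`HasSum`) on that ball, then `K` is complex differentiable on the ball — via Cauchy estimates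
`‖DF_ω‖ ≤ M_ω ∕ (R − r)` on each smaller ball `‖u‖ < r` and Mathlib's `hasFDerivAt_tsum_of_isPreconnected`.
[cite: Balaban1988RG2Cluster, p.15; Balaban1985BackgroundPropagators, Thm 3.10 p.416] -/
theorem differentiableOn_of_hasSum {W : Type*} {F : W → E → ℂ} {K : E → ℂ} {R : ℝ} {Mb : W → ℝ}
    (hF : ∀ ω, DifferentiableOn ℂ (F ω) (ball (0 : E) R)) (hM : ∀ ω, ∀ x ∈ ball (0 : E) R, ‖F ω x‖ ≤ Mb ω)
    (hMs : Summable Mb) (hK : ∀ x ∈ ball (0 : E) R, HasSum (fun ω => F ω x) (K x)) :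
    DifferentiableOn ℂ K (ball (0 : E) R) := by
  intro x hx
  obtain ⟨r, hxr, hrR⟩ := exists_between (mem_ball_zero_iff.1 hx)
  have hr0 : 0 < R - r := sub_pos.2 hrR
  have hsub : ball (0 : E) r ⊆ ball (0 : E) R := ball_subset_ball hrR.le
  have hderiv : ∀ ω y, y ∈ ball (0 : E) r → HasFDerivAt (F ω) (fderiv ℂ (F ω) y) y := fun ω y hy =>
    ((hF ω).differentiableAt (isOpen_ball.mem_nhds (hsub hy))).hasFDerivAt
  have hbound : ∀ ω y, y ∈ ball (0 : E) r → ‖fderiv ℂ (F ω) y‖ ≤ Mb ω / (R - r) := by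
    intro ω y hy
    refine (norm_fderiv_le_of_norm_le (hF ω) (hM ω) (hsub hy)).trans ?_
    have hy' : ‖y‖ < r := mem_ball_zero_iff.1 hy
    have hM0 : 0 ≤ Mb ω := (norm_nonneg _).trans (hM ω y (hsub hy))
    exact div_le_div_of_nonneg_left hM0 hr0 (by linarith)
  have hx' : x ∈ ball (0 : E) r := mem_ball_zero_iff.2 hxr
  have h0 : (0 : E) ∈ ball (0 : E) r := mem_ball_self ((norm_nonneg x).trans_lt hxr)
  have hsum0 : Summable fun ω => F ω 0 := (hK 0 (hsub h0)).summable
  have hT := hasFDerivAt_tsum_of_isPreconnected (hMs.div_const (R - r)) isOpen_ball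
    (convex_ball (0 : E) r).isPreconnected hderiv hbound h0 hsum0 hx'
  have heq : K =ᶠ[𝓝 x] fun y => ∑' ω, F ω y := by
    filter_upwards [isOpen_ball.mem_nhds hx] with y hy using ((hK y hy).tsum_eq).symm
  exact (hT.congr_of_eventuallyEq heq).differentiableAt.differentiableWithinAt

end Series

/-! ## §3. On polydisc × ball with walk majorants: the (T3b) analyticity binder shape BY NAME -/

section Torus

variable {d N' : ℕ} {ν : ℕ} {Nf : Fin ν → ℕ} [∀ i, NeZero (Nf i)]
variable {p n : Type}
variable {E : Type*} [NormedAddCommGroup E] [NormedSpace ℂ E]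

/-- **(T3b) ANALYTICITY FROM THE EXPANSION, on the site torus**: if for every σ of the polydisc the joint kernel
`u ↦ K(σ,u)(b,j)` is, on the `R`-ball, the entrywise `HasSum` of walk terms `u ↦ T_ω(σ,u)(b,j)` each complex
differentiable there, with per-term bounds `A_ω e^{−ρD_ω(loc b, loc j)}` uniform on polydisc × ball whose family has
`MajSumLe`-bounded partial sums (any bound `K̄`), then `u ↦ K(σ,u)(b,j)` is complex differentiable on the `R`-ball —
literally the binders `haΓ` (columns `Λ ⊕ C₀`) and `haE` (columns `Λ`) of `B13SigmaThroughWalks.differences216_of_walks_two`.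
[cite: Balaban1988RG2Cluster, p.15; Balaban1985BackgroundPropagators, Thm 3.10 p.416] -/
theorem differentiableOn_torus_of_hasSum (c : B13.Consts) (locp : p → UT Nf) (locn : n → UT Nf)
    (K2 : (TPt d N' → ℂ) → E → Matrix p n ℂ) {W : Type} {T2 : W → (TPt d N' → ℂ) → E → Matrix p n ℂ}
    {A : W → ℝ} {D : W → UT Nf → UT Nf → ℝ} {ρ R : ℝ} {Kbar : UT Nf → UT Nf → ℝ} (hA : ∀ ω, 0 ≤ A ω)
    (hK : ∀ σ : TPt d N' → ℂ, (∀ j, ‖σ j‖ ≤ Real.exp c.κ₁) → ∀ u ∈ ball (0 : E) R,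
      ∀ i j, HasSum (fun ω => T2 ω σ u i j) (K2 σ u i j))
    (hTa : ∀ ω, ∀ σ : TPt d N' → ℂ, (∀ j, ‖σ j‖ ≤ Real.exp c.κ₁) →
      ∀ i j, DifferentiableOn ℂ (fun u => T2 ω σ u i j) (ball (0 : E) R))
    (hmaj : ∀ ω, ∀ σ : TPt d N' → ℂ, (∀ j, ‖σ j‖ ≤ Real.exp c.κ₁) → ∀ u ∈ ball (0 : E) R,
      ∀ i j, ‖T2 ω σ u i j‖ ≤ A ω * Real.exp (-(ρ * D ω (locp i) (locn j))))
    (hsum : MajSumLe (g := toB6 (torusGeom Nf 0 0 0) 0 True) (fun ω a b => A ω * Real.exp (-(ρ * D ω a b))) Kbar) :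
    ∀ σ : TPt d N' → ℂ, (∀ j, ‖σ j‖ ≤ Real.exp c.κ₁) →
      ∀ b j, DifferentiableOn ℂ (fun u => K2 σ u b j) (ball (0 : E) R) := by
  intro σ hσ b j
  have hMs : Summable fun ω => A ω * Real.exp (-(ρ * D ω (locp b) (locn j))) :=
    summable_of_sum_le (fun ω => mul_nonneg (hA ω) (Real.exp_pos _).le) fun Sf => hsum Sf (locp b) (locn j)
  exact differentiableOn_of_hasSum (F := fun ω u => T2 ω σ u b j) (fun ω => hTa ω σ hσ b j)
    (fun ω u hu => hmaj ω σ hσ u hu b j) hMs (fun u hu => hK σ hσ u hu b j)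

end Torus

/-! ## §4. The grand capstone: `Differences216` for one (2.14)-term from THREE WALK EXPANSIONS -/

section Capstone

variable {E : Type*} [NormedAddCommGroup E] [NormedSpace ℂ E]
variable {d N' : ℕ} {ν : ℕ} {Nf : Fin ν → ℕ} [∀ i, NeZero (Nf i)]
variable {Λ : Type} [Fintype Λ] [DecidableEq Λ] {C₀ : Type}

/-- Termwise domination passes `MajSumLe` to the smaller family. [folklore] -/
private theorem majSumLe_of_le {g : B6.Geometry} {W : Type} {K₁ K₂ : W → g.Site → g.Site → ℝ}
    {Kbar : g.Site → g.Site → ℝ} (hle : ∀ ω a b, K₁ ω a b ≤ K₂ ω a b) (h : MajSumLe K₂ Kbar) :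
    MajSumLe K₁ Kbar :=
  fun S a b => (Finset.sum_le_sum fun ω _ => hle ω a b).trans (h S a b)

/-- With non-negative constants, non-negative walk distances and a non-negative rate drop, the full-rate majorants are
below the reduced-rate ones. [folklore] -/
private theorem maj_rate_le {g : B6.Geometry} {W : Type} {A : W → ℝ} {D : W → g.Site → g.Site → ℝ} {ρ ε : ℝ}
    (hA : ∀ ω, 0 ≤ A ω) (hD : ∀ ω a b, 0 ≤ D ω a b) (hε : 0 ≤ ε) (ω : W) (a b : g.Site) :
    A ω * Real.exp (-(ρ * D ω a b)) ≤ A ω * Real.exp (-((ρ - ε) * D ω a b)) :=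
  mul_le_mul_of_nonneg_left (Real.exp_le_exp.2 (by nlinarith [hD ω a b])) (hA ω)

/-- **`Differences216` (L16a) FOR ONE (2.14)-TERM FROM THREE WALK EXPANSIONS — no estimate assumed.**  Data: the joint
kernel families `G(σ,u)` (Γ-kernel of the term, rows `Λ`, columns `Λ ⊕ C₀`), `A(σ,u)` (precision) and `A(σ,u)⁻¹`
(covariance `C^{(k)}(Z₀,σ,𝐔,𝐉)`), σ on the polydisc `‖σ_j‖ ≤ e^{κ₁}`, `u` in the configuration space `E`, real reference
values `G(0,0) = Γ₀`, `A(0,0)⁻¹ = C ≻ 0`, bonds located on the site torus by `locΛ`, `locN` (`≤ m` per site); and THREE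
GENERALIZED RANDOM WALK EXPANSIONS with the printed structure: for the Γ-kernel and the precision — entrywise `HasSum`
on polydisc × `R`-ball, every term complex differentiable in `u` ([B9] Thm 3.10: a term is a function of the configuration
on `X̃₀⁵ ∪ … ∪ X̃ₙ⁵`), per-term bounds `A_ω e^{−ρD_ω(loc b, loc j)}` uniform on polydisc × ball ((1.11)∕(3.108)), reduced-rate
majorants `MajSumLe`-bounded by `K̄e^{−κd₁}`, non-negative walk distances, and AT THE REFERENCE CONFIGURATION the
σ-structure (terms outside the σ-carrying sub-family take their `σ = 0` value; σ-carrying walk distances pass `Through`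
`X`; `d₁(loc b, X) ≥ R_σ` — print: the cubes of `σ₀` lie outside `Z̃₀`, `dist(X, Z₀) > ⅔M`; packaged internally as
`B13SigmaThroughWalks.SigmaThroughWalks`); for the covariance — entrywise `HasSum` with uniform per-term bounds and a
`MajSumLe` bound `K̄_C e^{−κd₁}` only.  CONCLUSION: at every configuration `‖u‖ ≤ α < R` at which `A(σ,u)` is symmetric
with `Re ≻ 0` on the polydisc, the section `σ ↦ (A(σ,u), G(σ,u))` satisfies `Differences216` at any twice-dropped rate
`0 ≤ κ″ < κ′ < κ` with `θ_Γ = 2K̄_Γe^{−εR_σ} + 2K̄_Γα/R`, `θ_E = 2K̄_Ee^{−εR_σ} + 2K̄_Eα/R`,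
`θ_C = K̄_C·θ_E·(m(1+2/(κ−κ′))^ν)·K̄_C·(m(1+2/(κ′−κ″))^ν)` — print's `(O(1)e^{−⅓δ₀M} + O(α₀ + α₁))e^{−½δ₀|b₋−b′₋|}` with
every part a theorem: σ-part `B13SigmaThroughWalks.sub_ref_entry_le_torus`, (𝐔,𝐉)-part by the Schwarz lemma
(`B13PrimitiveKernels216.sub_ref_le_of_analytic`) from analyticity `differentiableOn_torus_of_hasSum` and majorants
`B13SigmaThroughWalks.majorant_torus_of_hasSum`, covariance by the resolvent identity
(`B13CovarianceDifference216.hdC_of_hdE`).  Together with `Localisation17a` from the same majorants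
(`B13PrimitiveKernels216.localisation17a_of_majorants`) this feeds r10's (2.26)-per-term capstone with NO kernel
estimate assumed. [cite: Balaban1988RG2Cluster, (2.16) p.16, p.15, p.13, (1.11) p.5; Balaban1985BackgroundPropagators, Thm 3.10 p.416, (3.154) p.427] -/
theorem differences216_of_walks (c : B13.Consts)
    (A2 : (TPt d N' → ℂ) → E → Matrix Λ Λ ℂ) (G2 : (TPt d N' → ℂ) → E → Matrix Λ (Λ ⊕ C₀) ℂ)
    {Γ₀ : Matrix Λ (Λ ⊕ C₀) ℝ} {C : Matrix Λ Λ ℝ} (hC : C.PosDef) (locΛ : Λ → UT Nf) (locN : Λ ⊕ C₀ → UT Nf)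
    {m : ℕ} (hfibΛ : ∀ x : UT Nf, (Finset.univ.filter fun i => locΛ i = x).card ≤ m)
    {R α kap kap' kap'' : ℝ} (hR : 0 < R) (hαR : α < R) (hα : 0 ≤ α)
    (hkap'' : 0 ≤ kap'') (h1 : kap'' < kap') (h2 : kap' < kap)
    (hG0 : G2 0 0 = Γ₀.map (algebraMap ℝ ℂ)) (hC0 : (A2 0 0)⁻¹ = C.map (algebraMap ℝ ℂ))
    {u : E} (hu : ‖u‖ ≤ α)
    (hAs : ∀ σ : TPt d N' → ℂ, (∀ j, ‖σ j‖ ≤ Real.exp c.κ₁) → (A2 σ u).IsSymm)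
    (hA : ∀ σ : TPt d N' → ℂ, (∀ j, ‖σ j‖ ≤ Real.exp c.κ₁) → ((A2 σ u).map Complex.re).PosDef)
    -- THE THREE WALK EXPANSIONS (objects): Γ-kernel `TΓ`, precision `TE`, covariance `TC`
    {WΓ : Type} {TΓ : WΓ → (TPt d N' → ℂ) → E → Matrix Λ (Λ ⊕ C₀) ℂ} {SXΓ : Set WΓ} {AΓ : WΓ → ℝ}
    {DΓ : WΓ → UT Nf → UT Nf → ℝ} {ρΓ : ℝ}
    {WE : Type} {TE : WE → (TPt d N' → ℂ) → E → Matrix Λ Λ ℂ} {SXE : Set WE} {AE : WE → ℝ}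
    {DE : WE → UT Nf → UT Nf → ℝ} {ρE : ℝ}
    {WC : Type} {TC : WC → (TPt d N' → ℂ) → E → Matrix Λ Λ ℂ} {AC : WC → ℝ}
    {DC : WC → UT Nf → UT Nf → ℝ} {ρC : ℝ}
    {X : Finset (UT Nf)} {ε Rσ KbarΓ KbarE KbarC : ℝ} (hε : 0 ≤ ε)
    (hKbarΓ : 0 ≤ KbarΓ) (hKbarE : 0 ≤ KbarE) (hKbarC : 0 ≤ KbarC)
    (hAΓ : ∀ ω, 0 ≤ AΓ ω) (hAE : ∀ ω, 0 ≤ AE ω) (hAC : ∀ ω, 0 ≤ AC ω)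
    (hDΓ : ∀ ω a b, 0 ≤ DΓ ω a b) (hDE : ∀ ω a b, 0 ≤ DE ω a b)
    -- Γ-kernel: joint expansion on polydisc × ball, termwise analytic, uniform per-term bounds, reduced-rate summability,
    -- σ-structure at the reference configuration
    (hKΓ : ∀ σ : TPt d N' → ℂ, (∀ j, ‖σ j‖ ≤ Real.exp c.κ₁) → ∀ u ∈ ball (0 : E) R,
      ∀ i j, HasSum (fun ω => TΓ ω σ u i j) (G2 σ u i j))
    (hTΓa : ∀ ω, ∀ σ : TPt d N' → ℂ, (∀ j, ‖σ j‖ ≤ Real.exp c.κ₁) →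
      ∀ i j, DifferentiableOn ℂ (fun u => TΓ ω σ u i j) (ball (0 : E) R))
    (hmajΓ : ∀ ω, ∀ σ : TPt d N' → ℂ, (∀ j, ‖σ j‖ ≤ Real.exp c.κ₁) → ∀ u ∈ ball (0 : E) R,
      ∀ i j, ‖TΓ ω σ u i j‖ ≤ AΓ ω * Real.exp (-(ρΓ * DΓ ω (locΛ i) (locN j))))
    (hsumΓ : MajSumLe (g := toB6 (torusGeom Nf 0 0 0) 0 True)
      (fun ω a b => AΓ ω * Real.exp (-((ρΓ - ε) * DΓ ω a b))) (fun a b => KbarΓ * Real.exp (-(kap * tdist1 Nf a b))))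
    (hindepΓ : ∀ ω, ω ∉ SXΓ → ∀ σ : TPt d N' → ℂ, (∀ j, ‖σ j‖ ≤ Real.exp c.κ₁) → TΓ ω σ 0 = TΓ ω 0 0)
    (hthrΓ : ∀ ω ∈ SXΓ, Through (toB6 (torusGeom Nf 0 0 0) 0 True) (DΓ ω) (↑X : Set (UT Nf)))
    -- precision: the same
    (hKE : ∀ σ : TPt d N' → ℂ, (∀ j, ‖σ j‖ ≤ Real.exp c.κ₁) → ∀ u ∈ ball (0 : E) R,
      ∀ i j, HasSum (fun ω => TE ω σ u i j) (A2 σ u i j))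
    (hTEa : ∀ ω, ∀ σ : TPt d N' → ℂ, (∀ j, ‖σ j‖ ≤ Real.exp c.κ₁) →
      ∀ i j, DifferentiableOn ℂ (fun u => TE ω σ u i j) (ball (0 : E) R))
    (hmajE : ∀ ω, ∀ σ : TPt d N' → ℂ, (∀ j, ‖σ j‖ ≤ Real.exp c.κ₁) → ∀ u ∈ ball (0 : E) R,
      ∀ i j, ‖TE ω σ u i j‖ ≤ AE ω * Real.exp (-(ρE * DE ω (locΛ i) (locΛ j))))
    (hsumE : MajSumLe (g := toB6 (torusGeom Nf 0 0 0) 0 True)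
      (fun ω a b => AE ω * Real.exp (-((ρE - ε) * DE ω a b))) (fun a b => KbarE * Real.exp (-(kap * tdist1 Nf a b))))
    (hindepE : ∀ ω, ω ∉ SXE → ∀ σ : TPt d N' → ℂ, (∀ j, ‖σ j‖ ≤ Real.exp c.κ₁) → TE ω σ 0 = TE ω 0 0)
    (hthrE : ∀ ω ∈ SXE, Through (toB6 (torusGeom Nf 0 0 0) 0 True) (DE ω) (↑X : Set (UT Nf)))
    -- covariance: joint expansion with uniform per-term bounds and a summability bound only
    (hKC : ∀ σ : TPt d N' → ℂ, (∀ j, ‖σ j‖ ≤ Real.exp c.κ₁) → ∀ u ∈ ball (0 : E) R,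
      ∀ i j, HasSum (fun ω => TC ω σ u i j) ((A2 σ u)⁻¹ i j))
    (hmajC : ∀ ω, ∀ σ : TPt d N' → ℂ, (∀ j, ‖σ j‖ ≤ Real.exp c.κ₁) → ∀ u ∈ ball (0 : E) R,
      ∀ i j, ‖TC ω σ u i j‖ ≤ AC ω * Real.exp (-(ρC * DC ω (locΛ i) (locΛ j))))
    (hsumC : MajSumLe (g := toB6 (torusGeom Nf 0 0 0) 0 True)
      (fun ω a b => AC ω * Real.exp (-(ρC * DC ω a b))) (fun a b => KbarC * Real.exp (-(kap * tdist1 Nf a b))))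
    -- geometry: the σ-carrying region is far from the row bonds
    (hfar : ∀ b : Λ, ∀ z ∈ X, Rσ ≤ tdist1 Nf (locΛ b) z) :
    Differences216 c (fun σ => A2 σ u) (fun σ => G2 σ u) Γ₀ C locΛ locN kap''
      (2 * KbarΓ * Real.exp (-(ε * Rσ)) + 2 * KbarΓ * α / R)
      (KbarC * (2 * KbarE * Real.exp (-(ε * Rσ)) + 2 * KbarE * α / R) * (m * (1 + 2 / (kap - kap')) ^ ν) * KbarC
        * (m * (1 + 2 / (kap' - kap'')) ^ ν))
      (2 * KbarE * Real.exp (-(ε * Rσ)) + 2 * KbarE * α / R) := by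
  have h0 : (0 : E) ∈ ball (0 : E) R := mem_ball_self hR
  -- the σ-structure of the two σ-sections at the reference configuration, packaged as `SigmaThroughWalks`
  have hwΓ : SigmaThroughWalks (toB6 (torusGeom Nf 0 0 0) 0 True) {σ : TPt d N' → ℂ | ∀ j, ‖σ j‖ ≤ Real.exp c.κ₁} 0
      locΛ locN (fun σ => G2 σ 0) (fun ω σ => TΓ ω σ 0) SXΓ X AΓ DΓ ρΓ :=
    ⟨fun σ hσ i j => hKΓ σ hσ 0 h0 i j, fun ω hω σ hσ => hindepΓ ω hω σ hσ, hthrΓ, hAΓ,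
      fun ω σ hσ i j => hmajΓ ω σ hσ 0 h0 i j⟩
  have hwE : SigmaThroughWalks (toB6 (torusGeom Nf 0 0 0) 0 True) {σ : TPt d N' → ℂ | ∀ j, ‖σ j‖ ≤ Real.exp c.κ₁} 0
      locΛ locΛ (fun σ => A2 σ 0) (fun ω σ => TE ω σ 0) SXE X AE DE ρE :=
    ⟨fun σ hσ i j => hKE σ hσ 0 h0 i j, fun ω hω σ hσ => hindepE ω hω σ hσ, hthrE, hAE,
      fun ω σ hσ i j => hmajE ω σ hσ 0 h0 i j⟩
  -- full-rate summability of the Γ-kernel's and the precision's majorants from the reduced-rate bounds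
  have hsumΓ' : MajSumLe (g := toB6 (torusGeom Nf 0 0 0) 0 True)
      (fun ω a b => AΓ ω * Real.exp (-(ρΓ * DΓ ω a b))) (fun a b => KbarΓ * Real.exp (-(kap * tdist1 Nf a b))) :=
    majSumLe_of_le (fun ω a b => maj_rate_le hAΓ hDΓ hε ω a b) hsumΓ
  have hsumE' : MajSumLe (g := toB6 (torusGeom Nf 0 0 0) 0 True)
      (fun ω a b => AE ω * Real.exp (-(ρE * DE ω a b))) (fun a b => KbarE * Real.exp (-(kap * tdist1 Nf a b))) :=
    majSumLe_of_le (fun ω a b => maj_rate_le hAE hDE hε ω a b) hsumE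
  exact differences216_of_walks_two c A2 G2 hC locΛ locN hfibΛ hR hαR hα hkap'' h1 h2 hKbarΓ hKbarC hKbarE hG0 hC0
    hu hAs hA hε hKbarΓ hKbarE hwΓ hsumΓ hwE hsumE hfar
    (differentiableOn_torus_of_hasSum c locΛ locN G2 hAΓ hKΓ hTΓa hmajΓ hsumΓ')
    (majorant_torus_of_hasSum c locΛ locN G2 hAΓ hKΓ hmajΓ hsumΓ')
    (differentiableOn_torus_of_hasSum c locΛ locΛ A2 hAE hKE hTEa hmajE hsumE')
    (majorant_torus_of_hasSum c locΛ locΛ A2 hAE hKE hmajE hsumE')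
    (majorant_torus_of_hasSum c locΛ locΛ (fun σ u => (A2 σ u)⁻¹) hAC hKC hmajC hsumC)

end Capstone

end

end Literature.MathematicalPhysics.QuantumFieldTheory.Balaban1983to89.B13ExpansionAnalytic
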